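import Summits.AtomisticToContinuum.HydrodynamicLimit.Theorems.ImplosionDichotomyPolynomialCompressionPcInit
import Summits.AtomisticToContinuum.HydrodynamicLimit.Theorems.ImplosionDichotomyPolynomialCompressionClosePrep
import Summits.AtomisticToContinuum.HydrodynamicLimit.Theorems.ImplosionDichotomyPolynomialCompressionCloseStep
import Summits.AtomisticToContinuum.HydrodynamicLimit.Theorems.ImplosionDichotomyPolynomialCompressionSolutionAPI
import Summits.AtomisticToContinuum.HydrodynamicLimit.Theorems.ImplosionDichotomyPolynomialCompressionReferenceJets
import Summits.AtomisticToContinuum.HydrodynamicLimit.Theorems.ImplosionDichotomyPolynomialCompressionCloseEnvelope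

/-!
# Closing of stub 4: the setting on an extended interval, and the bounds at `t = 0`

Helper file for the line `log-lipschitz-budget` of the crux `ImplosionDichotomy.PolynomialCompression`
(stmt-AtomisticToContinuum-12587), stub `stub_logBudgetShadowing`, the CLOSE.

* `pcClose_setting`: if the packing fraction of the σ-solution is `≤ η_s` on `[0, t] × 𝕋³`, then on a slightly
  longer interval `[0, t')` it is `< 2η_s ≤ η₂, η₃`, so that the rescaled law `ζ_σ` is smooth along the solution,
  the pressure is `ρθζ_σ(ρ)`, the packing-proportional bounds of orders `≤ 4` hold (`lbClose_eos_along`), and all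
  the hypotheses of the level estimates are in force: `ShadowSetting` and `ShadowEosHigher` on `[0, t')`.
* `pcClose_initial`: in the setting, the STRONG bounds of the continuous induction hold at `t = 0` — from the
  statics (`|δρ(0)|, |∂δρ(0)| ≤ Ĉσ³`, `δu(0) = δθ(0) = 0`), the envelope `r ≤ ρ₁(0)^{1/3} ≤ R` and the three
  initial smallness inequalities of `lbClose_smallness`; the energies by `pcClose_init_energies`.
* three pure-real lemmas of the level-3 contract `level3_contract`: the polynomial envelope of `l3base` against
  `X = T₁/(T₁ - s)` (`l3contract_base_le`), the window domination of the integrated rate (`l3contract_dominate`)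
  and the assembly of the energy-shell bound (`l3contract_assemble`).
-/

noncomputable section

namespace Summit.AtomisticToContinuum.HydrodynamicLimit.Theorems

open Set MeasureTheory Filter Topology
open Literature.MathematicalPhysics.KineticTheory Literature.Analysis.FunctionSpaces

/-- **The setting on an extended interval.** See the module docstring. [folklore] -/
theorem pcClose_setting :
    ∀ {η₀ η₂ η₃ ηs cZ₁ cZ₂ cZ K C T₁ cl pl σ T t : ℝ} {Cpoly ppoly Cstat : ℕ → ℝ}
      {ρ θ ρ₁ θ₁ : ℝ → T3 → ℝ} {u u₁ : ℝ → T3 → V3} {ζ : ℝ → ℝ} {J : Set ℝ},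
      IsOpen J → ContDiffOn ℝ (⊤ : ℕ∞) ζ J →
      (∀ (T : ℝ) (ρ θ : ℝ → T3 → ℝ) (u : ℝ → T3 → V3), IsHardSphereEulerSolution σ T ρ u θ →
        (∀ t ∈ Ico 0 T, ∀ x, ρ t x * σ ^ 3 < η₀) →
        (∀ t ∈ Ico 0 T, ∀ x, ρ t x ∈ J) ∧
        ∀ t ∈ Ico 0 T, ∀ x, hsPressure σ (ρ t x) (θ t x) = ρ t x * θ t x * ζ (ρ t x)) →
      (∀ r : ℝ, 0 ≤ r → r * σ ^ 3 ≤ η₂ → |ζ r - 1| ≤ cZ₁ * (r * σ ^ 3) ∧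
        |r * deriv ζ r| ≤ cZ₁ * (r * σ ^ 3) ∧ |r ^ 2 * deriv (deriv ζ) r| ≤ cZ₁ * (r * σ ^ 3)) →
      (∀ r : ℝ, 0 ≤ r → r * σ ^ 3 ≤ η₃ → |r ^ 3 * deriv (deriv (deriv ζ)) r| ≤ cZ₂ * (r * σ ^ 3) ∧
        |r ^ 4 * deriv (deriv (deriv (deriv ζ))) r| ≤ cZ₂ * (r * σ ^ 3)) →
      η₂ < η₀ → cZ₁ ≤ cZ → cZ₂ ≤ cZ → 2 * ηs ≤ η₂ → 2 * ηs ≤ η₃ → 0 < ηs →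
      IsHardSphereEulerSolution 0 T₁ ρ₁ u₁ θ₁ →
      (∀ t ∈ Ico 0 T₁, ∀ x, θ₁ t x = K * ρ₁ t x ^ (2 / 3 : ℝ)) →
      (∀ t ∈ Ico 0 T₁, ∀ x, ∀ i : Fin 3, ‖Torus.partialDeriv i (u₁ t) x‖ ≤ C / (T₁ - t) ∧
        |Torus.partialDeriv i (fun y => ρ₁ t y ^ (1 / 3 : ℝ)) x| ≤ C / (T₁ - t)) →
      (∀ n : ℕ, n ≤ 6 → ∀ t ∈ Ico 0 T₁, ∀ y : EuclideanSpace ℝ (Fin 3),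
        ‖iteratedFDeriv ℝ n (Torus.lift (ρ₁ t)) y‖ ≤ Cpoly n * (T₁ - t) ^ (-ppoly n) ∧
        ‖iteratedFDeriv ℝ n (Torus.lift (u₁ t)) y‖ ≤ Cpoly n * (T₁ - t) ^ (-ppoly n)) →
      (∀ t ∈ Ico 0 T₁, ∀ x, cl * (T₁ - t) ^ pl ≤ ρ₁ t x) →
      IsHardSphereEulerSolution σ T ρ u θ → T ≤ T₁ → 0 < σ → σ ≤ 1 → u 0 = u₁ 0 → θ 0 = θ₁ 0 →
      (∀ n : ℕ, n ≤ 6 → ∀ y : EuclideanSpace ℝ (Fin 3),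
        ‖iteratedFDeriv ℝ n (Torus.lift (fun x => ρ 0 x - ρ₁ 0 x)) y‖ ≤ Cstat n * σ ^ 3) →
      t ∈ Ico 0 T → (∀ s ∈ Icc 0 t, ∀ x, ρ s x * σ ^ 3 ≤ ηs) →
      ∃ t' : ℝ, t < t' ∧ t' ≤ T ∧
        ShadowSetting K C cZ T₁ cl pl Cpoly ppoly Cstat σ t' ρ θ ρ₁ θ₁ u u₁ ζ J ∧ ShadowEosHigher cZ σ t' ρ ζ := by
  intro η₀ η₂ η₃ ηs cZ₁ cZ₂ cZ K C T₁ cl pl σ T t Cpoly ppoly Cstat ρ θ ρ₁ θ₁ u u₁ ζ J hJ hζ hsol hlow hhigh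
    hη₂₀ hc1 hc2 h2η₂ h2η₃ hηs hE₁ hIsen hTI hpoly hfl hE hTT₁ hσ hσ1 hu0 hθ0 hst ht hpack
  obtain ⟨t', htt', ht'T, hpack'⟩ := pcClose_extend hE hσ.le ht hηs hpack
  have ht'T₁ : t' ≤ T₁ := ht'T.trans hTT₁
  have hEt : IsHardSphereEulerSolution σ t' ρ u θ := isHardSphereEulerSolution_restrict hE ht'T
  have hE₁t : IsHardSphereEulerSolution 0 t' ρ₁ u₁ θ₁ := isHardSphereEulerSolution_restrict hE₁ ht'T₁
  have hsub : ∀ s ∈ Ico 0 t', s ∈ Ico 0 T₁ := fun s hs => ⟨hs.1, hs.2.trans_le ht'T₁⟩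
  have hlt : ∀ s ∈ Ico 0 t', ∀ x, ρ s x * σ ^ 3 < η₀ := fun s hs x =>
    (hpack' s hs x).trans_le (h2η₂.trans hη₂₀.le)
  obtain ⟨hρJ, hP⟩ := hsol t' ρ θ u hEt hlt
  obtain ⟨hEos, hH⟩ := lbClose_eos_along hlow hhigh hc1 hc2 h2η₂ h2η₃ hσ.le
    (fun s hs x => ⟨hEt.density_pos s hs x, (hpack' s hs x).le⟩)
  refine ⟨t', htt', ht'T, ⟨hEt, hE₁t, hσ, hσ1, ht.1.trans_lt htt', ht'T₁, hJ, hζ, hρJ, hP, hEos,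
    fun s hs => hIsen s (hsub s hs), fun s hs => hTI s (hsub s hs), fun n hn s hs => hpoly n hn s (hsub s hs),
    fun s hs => hfl s (hsub s hs), hu0, hθ0, hst⟩, hH⟩

/-- **The STRONG bounds at `t = 0`.** See the module docstring. [folklore] -/
theorem pcClose_initial :
    ∀ {K C cZ T₁ cl pl σ T' ηs r R Ch Q₁ b₁ Q₂ b₂ Q₃ b₃ : ℝ} {Cpoly ppoly Cstat : ℕ → ℝ}
      {ρ θ ρ₁ θ₁ : ℝ → T3 → ℝ} {u u₁ : ℝ → T3 → V3} {ζ : ℝ → ℝ} {J : Set ℝ},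
      ShadowSetting K C cZ T₁ cl pl Cpoly ppoly Cstat σ T' ρ θ ρ₁ θ₁ u u₁ ζ J → 0 < K → 0 ≤ cZ → 0 < ηs →
      cZ * ηs ≤ 1 / 8 → 0 < r → 1 ≤ R → 0 < T₁ → (∀ n, 0 ≤ Cstat n) → (∀ n : ℕ, n ≤ 3 → Cstat n ≤ Ch) →
      (∀ x, r ≤ ρ₁ 0 x ^ (1 / 3 : ℝ) ∧ ρ₁ 0 x ^ (1 / 3 : ℝ) ≤ R) →
      Ch * σ ^ 3 ≤ r ^ 3 / 4 → (R ^ 3 + Ch) * σ ^ 3 ≤ ηs / 2 → Real.sqrt K / r ^ 2 * Ch * σ ^ 3 ≤ 1 / (2 * T₁) →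
      Cstat 1 * Real.sqrt (3 * (4 * K / r) / 2) ≤ Q₁ → Cstat 2 * Real.sqrt (9 * (4 * K / r) / 2) ≤ Q₂ →
      Cstat 3 * Real.sqrt (27 * (4 * K / r) / 2) ≤ Q₃ →
      (∀ x, |ρ 0 x - ρ₁ 0 x| ≤ ρ₁ 0 x / 4 ∧ |θ 0 x - θ₁ 0 x| ≤ θ₁ 0 x / 4 ∧
          ρ 0 x * σ ^ 3 ≤ ηs / 2 ∧ ‖u 0 x - u₁ 0 x‖ ≤ 1 ∧
          ∀ i : Fin 3,
            ‖Torus.partialDeriv i (u 0) x - Torus.partialDeriv i (u₁ 0) x‖ ≤ 1 / (2 * (T₁ - 0)) ∧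
            Real.sqrt (θ₁ 0 x) * |Torus.partialDeriv i (ρ 0) x - Torus.partialDeriv i (ρ₁ 0) x| /
                ρ₁ 0 x ≤ 1 / (2 * (T₁ - 0)) ∧
            |Torus.partialDeriv i (θ 0) x - Torus.partialDeriv i (θ₁ 0) x| / Real.sqrt (θ₁ 0 x) ≤
              1 / (2 * (T₁ - 0))) ∧
        Real.sqrt (shadowE1 ζ ρ θ u ρ₁ θ₁ u₁ 0) ≤ σ ^ 3 * Q₁ * (T₁ / (T₁ - 0)) ^ b₁ ∧
        Real.sqrt (shadowE2 ζ ρ θ u ρ₁ θ₁ u₁ 0) ≤ σ ^ 3 * Q₂ * (T₁ / (T₁ - 0)) ^ b₂ ∧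
        Real.sqrt (shadowE3 ζ ρ θ u ρ₁ θ₁ u₁ 0) ≤ σ ^ 3 * Q₃ * (T₁ / (T₁ - 0)) ^ b₃ := by
  intro K C cZ T₁ cl pl σ T' ηs r R Ch Q₁ b₁ Q₂ b₂ Q₃ b₃ Cpoly ppoly Cstat ρ θ ρ₁ θ₁ u u₁ ζ J hS hK hcZ hηs hcZηs hr
    hR hT₁ hCstat hCh henv hI0a hI0c hI1b hQ₁ hQ₂ hQ₃
  obtain ⟨hE, hE₁, hσ, hσ1, hT, -, -, -, -, -, hEos, hIsen, -, -, -, hu0, hθ0, hst⟩ := hS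
  have h0 : (0 : ℝ) ∈ Ico 0 T' := ⟨le_rfl, hT⟩
  have hσ3 : 0 ≤ σ ^ 3 := by positivity
  have hσ31 : σ ^ 3 ≤ 1 := pow_le_one₀ hσ.le hσ1
  have hCh0 : 0 ≤ Ch := (hCstat 0).trans (hCh 0 (by norm_num))
  have hsρ : Torus.IsSmooth (ρ 0) := hE.smooth_density.isSmooth_slice h0
  have hsρ₁ : Torus.IsSmooth (ρ₁ 0) := hE₁.smooth_density.isSmooth_slice h0
  have hsm : Torus.IsSmooth (fun y => ρ 0 y - ρ₁ 0 y) := hsρ.sub hsρ₁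
  have hX0 : T₁ / (T₁ - 0) = 1 := by rw [sub_zero, div_self hT₁.ne']
  -- the state at `t = 0`, pointwise
  have hpt : ∀ x, |ρ 0 x - ρ₁ 0 x| ≤ ρ₁ 0 x / 4 ∧ |θ 0 x - θ₁ 0 x| ≤ θ₁ 0 x / 4 ∧ ρ 0 x * σ ^ 3 ≤ ηs / 2 ∧
      ‖u 0 x - u₁ 0 x‖ ≤ 1 ∧ (0 ≤ shadowWeightA ζ ρ θ 0 x ∧ shadowWeightA ζ ρ θ 0 x ≤ 4 * K / r) ∧
      ∀ i : Fin 3,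
        ‖Torus.partialDeriv i (u 0) x - Torus.partialDeriv i (u₁ 0) x‖ ≤ 1 / (2 * (T₁ - 0)) ∧
        Real.sqrt (θ₁ 0 x) * |Torus.partialDeriv i (ρ 0) x - Torus.partialDeriv i (ρ₁ 0) x| / ρ₁ 0 x ≤
            1 / (2 * (T₁ - 0)) ∧
        |Torus.partialDeriv i (θ 0) x - Torus.partialDeriv i (θ₁ 0) x| / Real.sqrt (θ₁ 0 x) ≤
          1 / (2 * (T₁ - 0)) := by
    intro x
    have hρ₁ := hE₁.density_pos 0 h0 x
    have hρ := hE.density_pos 0 h0 x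
    obtain ⟨hc, hρ₁c, hθ₁c, hsq⟩ := isentropic_pointwise_algebra hK hρ₁ (hIsen 0 h0 x)
    obtain ⟨hrc, hcR⟩ := henv x
    generalize hcdef : ρ₁ 0 x ^ (1 / 3 : ℝ) = c at hc hρ₁c hθ₁c hsq hrc hcR
    -- statics: orders 0 and 1
    have hd0 : |ρ 0 x - ρ₁ 0 x| ≤ Ch * σ ^ 3 := by
      have h := hst 0 (by norm_num) (Torus.repr x)
      rw [norm_iteratedFDeriv_zero, Torus.lift_repr, Real.norm_eq_abs] at h
      exact h.trans (mul_le_mul_of_nonneg_right (hCh 0 (by norm_num)) hσ3)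
    have hd1 : ∀ i : Fin 3, |Torus.partialDeriv i (ρ 0) x - Torus.partialDeriv i (ρ₁ 0) x| ≤ Ch * σ ^ 3 := by
      intro i
      have h := (torus_partialDeriv_iter_le_of_lift_bounds hsm (M := fun n => Cstat n * σ ^ 3)
        (fun n hn y => hst n (by omega) y) x i i i i).1
      rw [lbClose_partialDeriv_sub (hsρ.isContDiff (by simp)) (hsρ₁.isContDiff (by simp)) i x] at h
      exact h.trans (mul_le_mul_of_nonneg_right (hCh 1 (by norm_num)) hσ3)
    have hr3 : r ^ 3 ≤ ρ₁ 0 x := by rw [hρ₁c]; exact pow_le_pow_left₀ hr.le hrc 3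
    have hc3 : ρ₁ 0 x ≤ R ^ 3 := by rw [hρ₁c]; exact pow_le_pow_left₀ hc.le hcR 3
    have hclose : |ρ 0 x - ρ₁ 0 x| ≤ ρ₁ 0 x / 4 := by linarith [hd0.trans hI0a]
    have hθ00 : θ 0 x - θ₁ 0 x = 0 := by rw [hθ0, sub_self]
    have hu00 : u 0 x - u₁ 0 x = 0 := by rw [hu0, sub_self]
    have hpack : ρ 0 x * σ ^ 3 ≤ ηs / 2 := by
      have h1 : ρ 0 x ≤ R ^ 3 + Ch := by
        have h2 : ρ 0 x ≤ ρ₁ 0 x + Ch * σ ^ 3 := by linarith [(abs_le.1 hd0).2]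
        have h3 : Ch * σ ^ 3 ≤ Ch := by simpa using mul_le_mul_of_nonneg_left hσ31 hCh0
        linarith
      exact (mul_le_mul_of_nonneg_right h1 hσ3).trans hI0c
    -- the weight `A(0)` from the point facts (`L = r`, `U = R`)
    have hθ₁pos : 0 < θ₁ 0 x := hE₁.temperature_pos 0 h0 x
    have hw1 : |ρ 0 x - c ^ 3| ≤ c ^ 3 / 2 := by rw [← hρ₁c]; linarith [hclose, abs_nonneg (ρ 0 x - ρ₁ 0 x)]
    have hw2 : |θ 0 x - K * c ^ 2| ≤ K * c ^ 2 / 2 := by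
      rw [← hθ₁c, hθ00, abs_zero]; linarith
    obtain ⟨he1, he2, -⟩ := hEos 0 h0 x
    have hpk : cZ * (ρ 0 x * σ ^ 3) ≤ 1 / 8 :=
      (mul_le_mul_of_nonneg_left (hpack.trans (by linarith)) hcZ).trans hcZηs
    obtain ⟨-, -, p3, p4, -⟩ := lbClose_point_facts hK hr hrc hcR rfl rfl hw1 hw2 (he1.trans hpk) (he2.trans hpk)
    have hA : shadowWeightA ζ ρ θ 0 x = θ 0 x * (ζ (ρ 0 x) + ρ 0 x * deriv ζ (ρ 0 x)) / ρ 0 x := rfl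
    have hAlo : 0 ≤ shadowWeightA ζ ρ θ 0 x := by rw [hA]; exact le_trans (by positivity) p3
    have hAhi : shadowWeightA ζ ρ θ 0 x ≤ 4 * K / r := by rw [hA]; exact p4
    -- the derivative bounds
    have hT0 : 1 / (2 * (T₁ - 0)) = 1 / (2 * T₁) := by rw [sub_zero]
    have hDn : 0 ≤ 1 / (2 * (T₁ - 0)) := by rw [hT0]; positivity
    refine ⟨hclose, by rw [hθ00, abs_zero]; positivity, hpack, by rw [hu00, norm_zero]; exact zero_le_one,
      ⟨hAlo, hAhi⟩, fun i => ⟨?_, ?_, ?_⟩⟩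
    · rw [hu0, sub_self, norm_zero]; exact hDn
    · rw [hT0, hsq, hρ₁c]
      have hK0 : 0 ≤ Real.sqrt K := Real.sqrt_nonneg K
      have e1 : Real.sqrt K * c * |Torus.partialDeriv i (ρ 0) x - Torus.partialDeriv i (ρ₁ 0) x| / c ^ 3 =
          Real.sqrt K / c ^ 2 * |Torus.partialDeriv i (ρ 0) x - Torus.partialDeriv i (ρ₁ 0) x| := by
        field_simp
      rw [e1]
      have h2 : Real.sqrt K / c ^ 2 ≤ Real.sqrt K / r ^ 2 :=
        div_le_div_of_nonneg_left hK0 (by positivity) (pow_le_pow_left₀ hr.le hrc 2)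
      calc Real.sqrt K / c ^ 2 * |Torus.partialDeriv i (ρ 0) x - Torus.partialDeriv i (ρ₁ 0) x|
          ≤ Real.sqrt K / r ^ 2 * (Ch * σ ^ 3) := mul_le_mul h2 (hd1 i) (abs_nonneg _) (by positivity)
        _ = Real.sqrt K / r ^ 2 * Ch * σ ^ 3 := by ring
        _ ≤ 1 / (2 * T₁) := hI1b
    · rw [hθ0, sub_self, abs_zero, zero_div]; exact hDn
  -- the energies at `t = 0`
  obtain ⟨e1, e2, e3⟩ := pcClose_init_energies hE hE₁ hT hu0 hθ0 hσ.le hCstat (fun x => (hpt x).2.2.2.2.1) hst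
  refine ⟨fun x => ⟨(hpt x).1, (hpt x).2.1, (hpt x).2.2.1, (hpt x).2.2.2.1, (hpt x).2.2.2.2.2⟩, ?_, ?_, ?_⟩
  · rw [hX0, Real.one_rpow, mul_one]; exact e1.trans (mul_le_mul_of_nonneg_left hQ₁ hσ3)
  · rw [hX0, Real.one_rpow, mul_one]; exact e2.trans (mul_le_mul_of_nonneg_left hQ₂ hσ3)
  · rw [hX0, Real.one_rpow, mul_one]; exact e3.trans (mul_le_mul_of_nonneg_left hQ₃ hσ3)

/-- Polynomial envelope of the base `l3base` against `X = T₁/(T₁ - s)` on `[0, T₁)`. [folklore] -/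
theorem l3contract_base_le {K cl pl T₁ : ℝ} {Cpoly ppoly : ℕ → ℝ} (hK : 0 < K) (hcl : 0 < cl) (hT₁ : 0 < T₁)
    (hC : ∀ n, 0 ≤ Cpoly n) :
    ∃ cb pb : ℝ, 0 ≤ cb ∧ 0 ≤ pb ∧ ∀ s : ℝ, 0 ≤ s → s < T₁ →
      0 ≤ l3base K cl pl T₁ Cpoly ppoly s ∧ l3base K cl pl T₁ Cpoly ppoly s ≤ cb * (T₁ / (T₁ - s)) ^ pb := by
  set p₁ : ℝ := ∑ n ∈ Finset.range 7, |ppoly n| with hp₁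
  set A₁ : ℝ := 1 + ∑ n ∈ Finset.range 7, Cpoly n * T₁ ^ (-ppoly n) with hA₁
  set A₂ : ℝ := 1 + cl⁻¹ * T₁ ^ (-pl) with hA₂
  have hp₁0 : 0 ≤ p₁ := Finset.sum_nonneg fun n _ => abs_nonneg _
  have hA₁0 : 0 ≤ A₁ := add_nonneg zero_le_one (Finset.sum_nonneg fun n _ => mul_nonneg (hC n) (Real.rpow_nonneg hT₁.le _))
  have hA₂0 : 0 ≤ A₂ := by positivity
  refine ⟨(1 + K + K⁻¹) * (576 * (1 + K) * A₁ ^ 5 * A₂ ^ 5) * (1 + T₁⁻¹), 5 * p₁ + 5 * |pl| + 1, by positivity,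
    by positivity, fun s hs0 hsT => ?_⟩
  have hl : 0 < T₁ - s := sub_pos.2 hsT
  have hX : 1 ≤ T₁ / (T₁ - s) := by rw [le_div_iff₀ hl]; linarith
  have hX0 : 0 < T₁ / (T₁ - s) := by linarith
  have hXle : ∀ {q q' : ℝ}, q ≤ q' → (T₁ / (T₁ - s)) ^ q ≤ (T₁ / (T₁ - s)) ^ q' := fun h =>
    Real.rpow_le_rpow_of_exponent_le hX h
  have hX1 : ∀ {q : ℝ}, 0 ≤ q → 1 ≤ (T₁ / (T₁ - s)) ^ q := fun h => Real.one_le_rpow hX h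
  have hXn : ∀ q : ℝ, 0 ≤ (T₁ / (T₁ - s)) ^ q := fun q => Real.rpow_nonneg hX0.le q
  -- the three factors
  have hlapse : ∀ p : ℝ, (T₁ - s) ^ (-p) = T₁ ^ (-p) * (T₁ / (T₁ - s)) ^ p := fun p => by
    rw [lbClose_rpow_lapse hT₁ hl, neg_neg]
  have f1 : 1 + ∑ n ∈ Finset.range 7, Cpoly n * (T₁ - s) ^ (-ppoly n) ≤ A₁ * (T₁ / (T₁ - s)) ^ p₁ := by
    have h1 : ∑ n ∈ Finset.range 7, Cpoly n * (T₁ - s) ^ (-ppoly n) ≤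
        (∑ n ∈ Finset.range 7, Cpoly n * T₁ ^ (-ppoly n)) * (T₁ / (T₁ - s)) ^ p₁ := by
      rw [Finset.sum_mul]
      refine Finset.sum_le_sum fun n hn => ?_
      rw [hlapse, ← mul_assoc]
      refine mul_le_mul_of_nonneg_left (hXle ((le_abs_self _).trans ?_)) (mul_nonneg (hC n) (Real.rpow_nonneg hT₁.le _))
      exact Finset.single_le_sum (f := fun n => |ppoly n|) (fun i _ => abs_nonneg _) hn
    calc 1 + ∑ n ∈ Finset.range 7, Cpoly n * (T₁ - s) ^ (-ppoly n)
        ≤ 1 * (T₁ / (T₁ - s)) ^ p₁ + (∑ n ∈ Finset.range 7, Cpoly n * T₁ ^ (-ppoly n)) * (T₁ / (T₁ - s)) ^ p₁ :=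
          add_le_add (by rw [one_mul]; exact hX1 hp₁0) h1
      _ = A₁ * (T₁ / (T₁ - s)) ^ p₁ := by rw [hA₁]; ring
  have f2 : 1 + (cl * (T₁ - s) ^ pl)⁻¹ ≤ A₂ * (T₁ / (T₁ - s)) ^ |pl| := by
    have h1 : (cl * (T₁ - s) ^ pl)⁻¹ = cl⁻¹ * (T₁ ^ (-pl) * (T₁ / (T₁ - s)) ^ pl) := by
      rw [mul_inv, ← Real.rpow_neg hl.le, hlapse]
    rw [h1]
    calc 1 + cl⁻¹ * (T₁ ^ (-pl) * (T₁ / (T₁ - s)) ^ pl)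
        ≤ 1 * (T₁ / (T₁ - s)) ^ |pl| + cl⁻¹ * T₁ ^ (-pl) * (T₁ / (T₁ - s)) ^ |pl| := by
          rw [← mul_assoc]
          exact add_le_add (by rw [one_mul]; exact hX1 (abs_nonneg _))
            (mul_le_mul_of_nonneg_left (hXle (le_abs_self _)) (by positivity))
      _ = A₂ * (T₁ / (T₁ - s)) ^ |pl| := by rw [hA₂]; ring
  have f3 : 1 + (T₁ - s)⁻¹ ≤ (1 + T₁⁻¹) * (T₁ / (T₁ - s)) := by
    have e : (T₁ - s)⁻¹ = T₁⁻¹ * (T₁ / (T₁ - s)) := by field_simp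
    rw [e, add_mul, one_mul]
    exact add_le_add hX le_rfl
  have hb1 : 0 ≤ 1 + ∑ n ∈ Finset.range 7, Cpoly n * (T₁ - s) ^ (-ppoly n) :=
    add_nonneg zero_le_one (Finset.sum_nonneg fun n _ => mul_nonneg (hC n) (Real.rpow_nonneg hl.le _))
  have hb2 : 0 ≤ 1 + (cl * (T₁ - s) ^ pl)⁻¹ := by positivity
  have hb3 : 0 ≤ 1 + (T₁ - s)⁻¹ := by positivity
  have hbase0 : 0 ≤ l3base K cl pl T₁ Cpoly ppoly s := by
    unfold l3base; positivity
  refine ⟨hbase0, ?_⟩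
  -- multiply the three envelopes
  have g1 : (1 + ∑ n ∈ Finset.range 7, Cpoly n * (T₁ - s) ^ (-ppoly n)) ^ 5 ≤ A₁ ^ 5 * (T₁ / (T₁ - s)) ^ (5 * p₁) := by
    calc (1 + ∑ n ∈ Finset.range 7, Cpoly n * (T₁ - s) ^ (-ppoly n)) ^ 5 ≤ (A₁ * (T₁ / (T₁ - s)) ^ p₁) ^ 5 :=
          pow_le_pow_left₀ hb1 f1 5
      _ = A₁ ^ 5 * (T₁ / (T₁ - s)) ^ (5 * p₁) := by
          rw [mul_pow, ← Real.rpow_natCast ((T₁ / (T₁ - s)) ^ p₁) 5, ← Real.rpow_mul hX0.le]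
          push_cast; ring_nf
  have g2 : (1 + (cl * (T₁ - s) ^ pl)⁻¹) ^ 5 ≤ A₂ ^ 5 * (T₁ / (T₁ - s)) ^ (5 * |pl|) := by
    calc (1 + (cl * (T₁ - s) ^ pl)⁻¹) ^ 5 ≤ (A₂ * (T₁ / (T₁ - s)) ^ |pl|) ^ 5 := pow_le_pow_left₀ hb2 f2 5
      _ = A₂ ^ 5 * (T₁ / (T₁ - s)) ^ (5 * |pl|) := by
          rw [mul_pow, ← Real.rpow_natCast ((T₁ / (T₁ - s)) ^ |pl|) 5, ← Real.rpow_mul hX0.le]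
          push_cast; ring_nf
  have hK1 : 0 ≤ 1 + K + K⁻¹ := by positivity
  unfold l3base
  calc (1 + K + K⁻¹) * (576 * (1 + K) * (1 + ∑ n ∈ Finset.range 7, Cpoly n * (T₁ - s) ^ (-ppoly n)) ^ 5 *
        (1 + (cl * (T₁ - s) ^ pl)⁻¹) ^ 5) * (1 + (T₁ - s)⁻¹)
      ≤ (1 + K + K⁻¹) * (576 * (1 + K) * (A₁ ^ 5 * (T₁ / (T₁ - s)) ^ (5 * p₁)) *
          (A₂ ^ 5 * (T₁ / (T₁ - s)) ^ (5 * |pl|))) * ((1 + T₁⁻¹) * (T₁ / (T₁ - s))) := by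
        refine mul_le_mul (mul_le_mul_of_nonneg_left ?_ hK1) f3 hb3 (by positivity)
        exact mul_le_mul (mul_le_mul_of_nonneg_left g1 (by positivity)) g2 (by positivity) (by positivity)
    _ = (1 + K + K⁻¹) * (576 * (1 + K) * A₁ ^ 5 * A₂ ^ 5) * (1 + T₁⁻¹) *
          ((T₁ / (T₁ - s)) ^ (5 * p₁) * (T₁ / (T₁ - s)) ^ (5 * |pl|) * (T₁ / (T₁ - s)) ^ (1 : ℝ)) := by
        rw [Real.rpow_one]; ring
    _ = (1 + K + K⁻¹) * (576 * (1 + K) * A₁ ^ 5 * A₂ ^ 5) * (1 + T₁⁻¹) * (T₁ / (T₁ - s)) ^ (5 * p₁ + 5 * |pl| + 1) := by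
        rw [← Real.rpow_add hX0, ← Real.rpow_add hX0]

/-- The window bounds of the contract: with `P = κ B^a ≤ κ c_b^a X^{a p_b}`, `S = σ³ Q_S X^{b_S}`,
`σ³(Q_S + 1)X^N ≤ 1`, `N = a p_b + b_S`, and the lower level bounds `√E_k ≤ σ³ Q_in X^{b_in}`, the integrated
rate is dominated by `(Λ/(T₁-t) + c₁) E₃ + σ³ c₂ (1 + Q_in) X^{a p_b + b_in} √E₃`. [folklore] -/
theorem l3contract_dominate {κ cb B X σ3 cZ QS Qin bS bin pb Λl E0 E1 E2 E3 sE3 : ℝ} {a : ℕ} (hκ : 0 < κ)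
    (hcb : 0 ≤ cb) (hpb : 0 ≤ pb) (hB0 : 0 ≤ B) (hB : B ≤ cb * X ^ pb) (hX : 1 ≤ X) (hσ0 : 0 ≤ σ3) (hσ1 : σ3 ≤ 1) (hcZ : 0 ≤ cZ)
    (hQS : 0 ≤ QS) (hQin : 0 ≤ Qin) (hbS : 0 ≤ bS) (hbin : 0 ≤ bin) (hwin : σ3 * (QS + 1) * X ^ ((a : ℝ) * pb + bS) ≤ 1)
    (h0 : Real.sqrt E0 ≤ σ3 * Qin * X ^ bin) (h1 : Real.sqrt E1 ≤ σ3 * Qin * X ^ bin)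
    (h2 : Real.sqrt E2 ≤ σ3 * Qin * X ^ bin) (hs3 : 0 ≤ sE3) (hE3 : 0 ≤ E3) :
    (Λl + κ * B ^ a * (σ3 * QS * X ^ bS + σ3 * QS * X ^ bS + cZ * σ3)) * E3 +
        κ * B ^ a * (Real.sqrt E0 + Real.sqrt E1 + (1 + σ3 * QS * X ^ bS + σ3 * QS * X ^ bS + cZ * σ3) *
          Real.sqrt E2 + σ3) * sE3 ≤
      (Λl + κ * cb ^ a * (2 + cZ)) * E3 + σ3 * (κ * cb ^ a * (6 + cZ)) * (1 + Qin) * X ^ ((a : ℝ) * pb + bin) * sE3 := by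
  have hX0 : 0 < X := by linarith
  have hXn : ∀ q : ℝ, 0 ≤ X ^ q := fun q => Real.rpow_nonneg hX0.le q
  have hX1 : ∀ {q : ℝ}, 0 ≤ q → 1 ≤ X ^ q := fun h => Real.one_le_rpow hX h
  have hXle : ∀ {q q' : ℝ}, q ≤ q' → X ^ q ≤ X ^ q' := fun h => Real.rpow_le_rpow_of_exponent_le hX h
  -- `B^a ≤ cb^a X^{a pb}`
  have hBa : B ^ a ≤ cb ^ a * X ^ ((a : ℝ) * pb) := by
    calc B ^ a ≤ (cb * X ^ pb) ^ a := pow_le_pow_left₀ hB0 hB a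
      _ = cb ^ a * X ^ ((a : ℝ) * pb) := by
          rw [mul_pow, ← Real.rpow_natCast (X ^ pb) a, ← Real.rpow_mul hX0.le, mul_comm pb]
  have hP : κ * B ^ a ≤ κ * cb ^ a * X ^ ((a : ℝ) * pb) := by
    rw [mul_assoc]; exact mul_le_mul_of_nonneg_left hBa hκ.le
  have hP0 : 0 ≤ κ * B ^ a := by positivity
  -- the window consequences
  have hapb : 0 ≤ (a : ℝ) * pb := by positivity
  have hqN : 0 ≤ σ3 * QS * X ^ ((a : ℝ) * pb + bS) := by have := hXn ((a : ℝ) * pb + bS); positivity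
  have hw1 : σ3 * X ^ ((a : ℝ) * pb + bS) ≤ 1 := by
    have : σ3 * X ^ ((a : ℝ) * pb + bS) ≤ σ3 * (QS + 1) * X ^ ((a : ℝ) * pb + bS) := by linarith
    exact this.trans hwin
  have hS1 : σ3 * QS * X ^ bS ≤ 1 := by
    have e1 : σ3 * QS * X ^ bS ≤ σ3 * QS * X ^ ((a : ℝ) * pb + bS) :=
      mul_le_mul_of_nonneg_left (hXle (by linarith)) (mul_nonneg hσ0 hQS)
    have e2 : σ3 * QS * X ^ ((a : ℝ) * pb + bS) ≤ σ3 * (QS + 1) * X ^ ((a : ℝ) * pb + bS) := by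
      linarith [mul_nonneg hσ0 (hXn ((a : ℝ) * pb + bS))]
    exact e1.trans (e2.trans hwin)
  have hS0 : 0 ≤ σ3 * QS * X ^ bS := by have := hXn bS; positivity
  have hPS : κ * B ^ a * (σ3 * QS * X ^ bS) ≤ κ * cb ^ a := by
    calc κ * B ^ a * (σ3 * QS * X ^ bS) ≤ κ * cb ^ a * X ^ ((a : ℝ) * pb) * (σ3 * QS * X ^ bS) :=
          mul_le_mul_of_nonneg_right hP hS0
      _ = κ * cb ^ a * (σ3 * QS * X ^ ((a : ℝ) * pb + bS)) := by rw [Real.rpow_add hX0]; ring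
      _ ≤ κ * cb ^ a * 1 := by
          refine mul_le_mul_of_nonneg_left ?_ (by positivity)
          calc σ3 * QS * X ^ ((a : ℝ) * pb + bS) ≤ σ3 * (QS + 1) * X ^ ((a : ℝ) * pb + bS) := by
                linarith [mul_nonneg hσ0 (hXn ((a : ℝ) * pb + bS))]
            _ ≤ 1 := hwin
      _ = κ * cb ^ a := mul_one _
  have hPz : κ * B ^ a * (cZ * σ3) ≤ κ * cb ^ a * cZ := by
    calc κ * B ^ a * (cZ * σ3) ≤ κ * cb ^ a * X ^ ((a : ℝ) * pb) * (cZ * σ3) :=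
          mul_le_mul_of_nonneg_right hP (by positivity)
      _ = κ * cb ^ a * cZ * (σ3 * X ^ ((a : ℝ) * pb)) := by ring
      _ ≤ κ * cb ^ a * cZ * 1 := by
          refine mul_le_mul_of_nonneg_left ?_ (by positivity)
          calc σ3 * X ^ ((a : ℝ) * pb) ≤ σ3 * X ^ ((a : ℝ) * pb + bS) := mul_le_mul_of_nonneg_left (hXle (by linarith)) hσ0
            _ ≤ 1 := hw1
      _ = κ * cb ^ a * cZ := mul_one _
  -- first group
  have hfirst : (Λl + κ * B ^ a * (σ3 * QS * X ^ bS + σ3 * QS * X ^ bS + cZ * σ3)) * E3 ≤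
      (Λl + κ * cb ^ a * (2 + cZ)) * E3 := by
    refine mul_le_mul_of_nonneg_right ?_ hE3
    have e : κ * B ^ a * (σ3 * QS * X ^ bS + σ3 * QS * X ^ bS + cZ * σ3) =
        κ * B ^ a * (σ3 * QS * X ^ bS) + κ * B ^ a * (σ3 * QS * X ^ bS) + κ * B ^ a * (cZ * σ3) := by ring
    rw [e]
    linarith [hPS, hPz]
  -- second group
  have hbr : Real.sqrt E0 + Real.sqrt E1 + (1 + σ3 * QS * X ^ bS + σ3 * QS * X ^ bS + cZ * σ3) * Real.sqrt E2 + σ3 ≤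
      σ3 * (6 + cZ) * (1 + Qin) * X ^ bin := by
    have hq : 0 ≤ σ3 * Qin * X ^ bin := by have := hXn bin; positivity
    have hc3 : (1 + σ3 * QS * X ^ bS + σ3 * QS * X ^ bS + cZ * σ3) ≤ 3 + cZ := by nlinarith
    have e2 : (1 + σ3 * QS * X ^ bS + σ3 * QS * X ^ bS + cZ * σ3) * Real.sqrt E2 ≤ (3 + cZ) * (σ3 * Qin * X ^ bin) :=
      mul_le_mul hc3 h2 (Real.sqrt_nonneg _) (by positivity)
    have e3 : σ3 ≤ σ3 * X ^ bin := le_mul_of_one_le_right hσ0 (hX1 hbin)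
    have hXb := hXn bin
    have e4 : Real.sqrt E0 + Real.sqrt E1 + (1 + σ3 * QS * X ^ bS + σ3 * QS * X ^ bS + cZ * σ3) * Real.sqrt E2 + σ3 ≤
        (5 + cZ) * (σ3 * Qin * X ^ bin) + σ3 * X ^ bin := by linarith
    have e5 : (5 + cZ) * (σ3 * Qin * X ^ bin) + σ3 * X ^ bin = σ3 * X ^ bin * ((5 + cZ) * Qin + 1) := by ring
    have e6 : σ3 * (6 + cZ) * (1 + Qin) * X ^ bin = σ3 * X ^ bin * ((6 + cZ) * (1 + Qin)) := by ring
    rw [e6]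
    refine e4.trans ?_
    rw [e5]
    exact mul_le_mul_of_nonneg_left (by nlinarith [mul_nonneg hcZ hQin]) (mul_nonneg hσ0 hXb)
  have hsecond : κ * B ^ a * (Real.sqrt E0 + Real.sqrt E1 +
      (1 + σ3 * QS * X ^ bS + σ3 * QS * X ^ bS + cZ * σ3) * Real.sqrt E2 + σ3) * sE3 ≤
      σ3 * (κ * cb ^ a * (6 + cZ)) * (1 + Qin) * X ^ ((a : ℝ) * pb + bin) * sE3 := by
    refine mul_le_mul_of_nonneg_right ?_ hs3
    calc κ * B ^ a * (Real.sqrt E0 + Real.sqrt E1 +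
          (1 + σ3 * QS * X ^ bS + σ3 * QS * X ^ bS + cZ * σ3) * Real.sqrt E2 + σ3)
        ≤ (κ * cb ^ a * X ^ ((a : ℝ) * pb)) * (σ3 * (6 + cZ) * (1 + Qin) * X ^ bin) :=
          mul_le_mul hP hbr (by
            have := hXn bS; have := hXn bin
            have : 0 ≤ (1 + σ3 * QS * X ^ bS + σ3 * QS * X ^ bS + cZ * σ3) * Real.sqrt E2 := by positivity
            positivity) (by have := hXn ((a : ℝ) * pb); positivity)
      _ = σ3 * (κ * cb ^ a * (6 + cZ)) * (1 + Qin) * (X ^ ((a : ℝ) * pb) * X ^ bin) := by ring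
      _ = σ3 * (κ * cb ^ a * (6 + cZ)) * (1 + Qin) * X ^ ((a : ℝ) * pb + bin) := by rw [← Real.rpow_add hX0]
  exact add_le_add hfirst hsecond

/-- Pure-real assembly of the shell bound: `√E(t) ≤ e^{…}(√E(0) + ½∫G)` with `e^{…} ≤ X^{Λ/2} e_c`,
`∫G ≤ T₁ G(t)`, `√E(0) ≤ σ³ C_i` gives `√E(t) ≤ σ³ (e_c (C_i + T₁c₂/2)(1 + Q_in)) X^{q} X^{Λ/2}`. [folklore] -/
theorem l3contract_assemble {sEt sE0 IG EXPF Xl Xq ec σ3 Ci T₁ c₂ Qin : ℝ}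
    (hk : sEt ≤ EXPF * (sE0 + IG / 2)) (hexp : EXPF ≤ Xl * ec) (hG : IG ≤ T₁ * (σ3 * c₂ * (1 + Qin) * Xq))
    (hinit : sE0 ≤ σ3 * Ci) (hXq : 1 ≤ Xq) (hXl : 0 ≤ Xl) (hec : 0 ≤ ec) (hσ3 : 0 ≤ σ3) (hCi : 0 ≤ Ci)
    (hQin : 0 ≤ Qin) (hE0 : 0 ≤ sE0) (hIG : 0 ≤ IG) :
    sEt ≤ σ3 * (ec * (Ci + T₁ * c₂ / 2) * (1 + Qin)) * (Xq * Xl) := by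
  have h1 : σ3 * Ci ≤ σ3 * Ci * (1 + Qin) * Xq := by
    have h2 : σ3 * Ci ≤ σ3 * Ci * (1 + Qin) := le_mul_of_one_le_right (by positivity) (by linarith)
    exact h2.trans (le_mul_of_one_le_right (by positivity) hXq)
  have hM : sE0 + IG / 2 ≤ σ3 * (Ci + T₁ * c₂ / 2) * (1 + Qin) * Xq := by
    have e : σ3 * (Ci + T₁ * c₂ / 2) * (1 + Qin) * Xq =
        σ3 * Ci * (1 + Qin) * Xq + T₁ * (σ3 * c₂ * (1 + Qin) * Xq) / 2 := by ring
    rw [e]; linarith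
  have hM0 : 0 ≤ sE0 + IG / 2 := by positivity
  calc sEt ≤ EXPF * (sE0 + IG / 2) := hk
    _ ≤ (Xl * ec) * (σ3 * (Ci + T₁ * c₂ / 2) * (1 + Qin) * Xq) := mul_le_mul hexp hM hM0 (mul_nonneg hXl hec)
    _ = σ3 * (ec * (Ci + T₁ * c₂ / 2) * (1 + Qin)) * (Xq * Xl) := by ring

end Summit.AtomisticToContinuum.HydrodynamicLimit.Theorems

end
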